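/-
Copyright (c) 2026 the pub-hodgecm-mathlib formalisation cell (harness21).  Prover seat hodgecm-mathlib-F0P2-p02 (g10): road «S3-tree» (LEAD F0P3a-plan (g11) WORD T10-2;
architect A-p16 (g29) A-60∕A-63: «T2-S apartment ∕ tube per period STANDS»), brick T2-S, FILE 4a = THE SPLIT TORUS ON ITS APARTMENT; 2026-09-01.
-/
import Literature.NumberTheory.Automorphic.UnitaryLatticeTreeApartment     -- ★ T1 (B-p14 (g35)): `exists_coe_eq_diagonal_zpow`, `mapGL_coe_latt_eq`, `diagonal_three_mul`, the apartment vertices `L_a`, `L′_a`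
import Literature.NumberTheory.Automorphic.UnitaryLatticeTreeSelfDualFrames -- ★ T1 (B-p14 (g35)): `latt_diagonal_congr`, `mem_latt_diagonal_iff`
import HarnessLib

/-!
# The split rank-one torus of `U(3)` on its apartment: the compact part fixes every apartment vertex, `t_c = diag(ϖ^c, 1, ϖ^{−c})` translates by `c` (Bruhat–Tits 1972 §10; Serre, *Trees* I.6.4, II.1.1)

Topic `NumberTheory/Automorphic`; namespace `Literature.NumberTheory.Automorphic.UnitaryLatticeTree` (T1a's).  THEOREMS ONLY: no definition, no named fact, no instance, no
notation, no `sorry`.  Cell `pub/hodgecm-mathlib` (D-0151), crux H413 = `stmt-HodgeConjecture-24833`; road «S3-tree» (target `stub_N6nsS3id` of «N6nsGerm» ED. 1.15), brick **T2-S**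
(«apartment ∕ tube per period» for the split-rank-one torus type — architect A-63 (1): STANDS), holder F0P2-p02 (g10), FILE 4a.  HONEST LABEL: HC_CM is proved only modulo the 2 remaining
named inputs (hLiu418 24832, h413 24833) until rung 0 closes; nothing printed is asserted here — lattice algebra over a valuation ring.

THE MATHEMATICS (frame `H = J₀ = antidiag(1,1,1)` of ★ `UnitaryLatticeTreeApartment`; apartment vertices `L_a = latt diag(ϖ^a, 1, ϖ^{−a})` (self-dual) and
`L′_a = latt diag(ϖ^a, 1, ϖ^{1−a})` (type 2), ★ B-p14).  The split torus of `U(σ, J₀)` is diagonal: `diag(u, s, (σu)⁻¹)` with `s·σs = 1`.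
* §1 (rank `N`, any `H`): **`mapGL_latt_diagonal_of_unit_diagonal`**: a DIAGONAL element all of whose entries are UNITS fixes EVERY
  diagonal lattice `latt diag(d)` of its frame — the compact part of a split torus fixes its apartment POINTWISE (census T2 §2 (S1′); the `n` diagonal case of ★ FILE 0
  `mapGL_conj_latt_mul_eq_of_diagonal`, here by the direct valuation computation).
* §2 (`N = 3`, `H = J₀`): **`mapGL_latt_apartment_selfDual_of_units` ∕ `…_two_of_units`**: `diag(u, s, w)` with `|u| = |s| = |w| = 1` fixes `L_a` and `L′_a` for every `a : ℤ`;
  **`mapGL_latt_apartment_selfDual_translate` ∕ `…_two_translate`**: the torus element `t_c` with matrix `diag(ϖ^c, 1, ϖ^{−c})` (★ `exists_coe_eq_diagonal_zpow`) maps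
  `L_a ↦ L_{a+c}` and `L′_a ↦ L′_{a+c}` — the TRANSLATION of the apartment by the non-compact part (period `c = 1` in self-dual steps; at a ramified place the uniformiser of
  `F` has `c = e`).  With ★ F0P2-p02 (g9) `TreeActionAxisPerPeriod` ∕ ★ F0P3a-p08 `TreeHereditaryLayerCount` these are the two inputs of the per-period tube counts; the
  transversal structure at each foot is the DEPTH RECURSION of T4′ (architect A-63), not a torus-shell law.

## References
* [BruhatTits1972] F. Bruhat, J. Tits, *Groupes réductifs sur un corps local I*, Publ. Math. IHÉS 41 (1972), §10 (apartments of the lattice model; the split torus acts by translations).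
* [Serre1980Trees] J.-P. Serre, *Trees* (1980), Ch. I §6.4 Prop. 24–25 (hyperbolic automorphisms and their axis), Ch. II §1.1 (lattices, the diagonal torus of `GL₂`).
-/

set_option autoImplicit false

noncomputable section

open scoped Valued WithZero Matrix MatrixGroups

namespace Literature.NumberTheory.Automorphic.UnitaryLatticeTree

open Literature.NumberTheory.Automorphic Literature.NumberTheory.Automorphic.HermitianLattice

variable {K : Type*} [Field K] [Valued K ℤᵐ⁰] {N : ℕ}

/-! ## §1 A unit diagonal element fixes every diagonal lattice of its frame (rank `N`) -/

/-- `g · latt A = latt (g A)` for `g ∈ GL_N(K)` and any matrix `A` (local copy of ★ `mapGL_latt_eq` of `UnitaryLatticeTreeTypeTwoNormalForm`, B-p14, to keep this file's imports light). [cite: Serre1980Trees, II.1.1] -/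
private theorem mapGL_latt_eq_aux (g : GL (Fin N) K) (A : Matrix (Fin N) (Fin N) K) : mapGL g (latt A) = latt ((g : Matrix (Fin N) (Fin N) K) * A) := by
  rw [mapGL, latt_mul]

/-- **A DIAGONAL element with UNIT entries fixes every DIAGONAL lattice of the same frame**: `diag(s) · latt diag(d) = latt diag(s·d) = latt diag(d)` (`|s_i| = 1`, `d_i ≠ 0`) —
the compact part of a split torus fixes its apartment pointwise. [cite: BruhatTits1972, §10] [cite: Serre1980Trees, II.1.1] -/
theorem mapGL_latt_diagonal_of_unit_diagonal (δ : GL (Fin N) K) (s d : Fin N → K) (hδ : (δ : Matrix (Fin N) (Fin N) K) = Matrix.diagonal s)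
    (hs : ∀ i, Valued.v (s i) = 1) (hd : ∀ i, d i ≠ 0) :
    mapGL δ (latt (Matrix.diagonal d)) = latt (Matrix.diagonal d) := by
  rw [mapGL_latt_eq_aux, hδ, Matrix.diagonal_mul_diagonal]
  refine latt_diagonal_congr (fun i => mul_ne_zero (fun h0 => ?_) (hd i)) (fun i => ?_)
  · have := hs i; rw [h0, map_zero] at this; exact zero_ne_one this
  · rw [map_mul, hs i, one_mul]

/-! ## §2 The split torus of `U(3)` on the apartment `{L_a, L′_a}` of the frame `J₀` -/

/-- **The compact part fixes the self-dual apartment vertices**: `diag(u, s, w)` with unit entries fixes `L_a = latt diag(ϖ^a, 1, ϖ^{−a})` (`ϖ ≠ 0`).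
[cite: BruhatTits1972, §10] [cite: Serre1980Trees, I.6.4] -/
theorem mapGL_latt_apartment_selfDual_of_units (δ : GL (Fin 3) K) (u s w ϖ : K) (hδ : (δ : Matrix (Fin 3) (Fin 3) K) = Matrix.diagonal ![u, s, w])
    (hu : Valued.v u = 1) (hs : Valued.v s = 1) (hw : Valued.v w = 1) (hϖ : ϖ ≠ 0) (a : ℤ) :
    mapGL δ (latt (Matrix.diagonal ![ϖ ^ a, 1, ϖ ^ (-a)])) = latt (Matrix.diagonal ![ϖ ^ a, 1, ϖ ^ (-a)]) := by
  refine mapGL_latt_diagonal_of_unit_diagonal δ _ _ hδ (fun i => ?_) (fun i => ?_)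
  · fin_cases i <;> assumption
  · fin_cases i
    · exact zpow_ne_zero a hϖ
    · exact one_ne_zero
    · exact zpow_ne_zero (-a) hϖ

/-- **The compact part fixes the type-two apartment vertices**: `diag(u, s, w)` with unit entries fixes `L′_a = latt diag(ϖ^a, 1, ϖ^{1−a})` (`ϖ ≠ 0`).
[cite: BruhatTits1972, §10] [cite: Serre1980Trees, I.6.4] -/
theorem mapGL_latt_apartment_two_of_units (δ : GL (Fin 3) K) (u s w ϖ : K) (hδ : (δ : Matrix (Fin 3) (Fin 3) K) = Matrix.diagonal ![u, s, w])
    (hu : Valued.v u = 1) (hs : Valued.v s = 1) (hw : Valued.v w = 1) (hϖ : ϖ ≠ 0) (a : ℤ) :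
    mapGL δ (latt (Matrix.diagonal ![ϖ ^ a, 1, ϖ ^ (1 - a)])) = latt (Matrix.diagonal ![ϖ ^ a, 1, ϖ ^ (1 - a)]) := by
  refine mapGL_latt_diagonal_of_unit_diagonal δ _ _ hδ (fun i => ?_) (fun i => ?_)
  · fin_cases i <;> assumption
  · fin_cases i
    · exact zpow_ne_zero a hϖ
    · exact one_ne_zero
    · exact zpow_ne_zero (1 - a) hϖ

/-- **The translation `t_c = diag(ϖ^c, 1, ϖ^{−c})` shifts the self-dual apartment vertices: `t_c · L_a = L_{a+c}`** (`ϖ ≠ 0`; `t_c ∈ U(σ, J₀)` by ★ `exists_coe_eq_diagonal_zpow`).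
[cite: BruhatTits1972, §10] [cite: Serre1980Trees, I.6.4] -/
theorem mapGL_latt_apartment_selfDual_translate (t : GL (Fin 3) K) (ϖ : K) (hϖ : ϖ ≠ 0) (c a : ℤ)
    (ht : (t : Matrix (Fin 3) (Fin 3) K) = Matrix.diagonal ![ϖ ^ c, 1, ϖ ^ (-c)]) :
    mapGL t (latt (Matrix.diagonal ![ϖ ^ a, 1, ϖ ^ (-a)])) = latt (Matrix.diagonal ![ϖ ^ (a + c), 1, ϖ ^ (-(a + c))]) := by
  rw [mapGL_latt_eq_aux, ht, diagonal_three_mul, one_mul, ← zpow_add₀ hϖ, ← zpow_add₀ hϖ, add_comm c a, neg_add, add_comm (-c) (-a)]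

/-- **The translation shifts the type-two apartment vertices: `t_c · L′_a = L′_{a+c}`** (`ϖ ≠ 0`). [cite: BruhatTits1972, §10] [cite: Serre1980Trees, I.6.4] -/
theorem mapGL_latt_apartment_two_translate (t : GL (Fin 3) K) (ϖ : K) (hϖ : ϖ ≠ 0) (c a : ℤ)
    (ht : (t : Matrix (Fin 3) (Fin 3) K) = Matrix.diagonal ![ϖ ^ c, 1, ϖ ^ (-c)]) :
    mapGL t (latt (Matrix.diagonal ![ϖ ^ a, 1, ϖ ^ (1 - a)])) = latt (Matrix.diagonal ![ϖ ^ (a + c), 1, ϖ ^ (1 - (a + c))]) := by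
  rw [mapGL_latt_eq_aux, ht, diagonal_three_mul, one_mul, ← zpow_add₀ hϖ, ← zpow_add₀ hϖ, add_comm c a]
  congr 3
  ring

/-- **The translation acts FREELY on the self-dual apartment vertices**: `t_c · L_a = L_a` forces `c = 0` (`|ϖ| = exp(−1)` a uniformiser: `latt diag(ϖ^{a+c}, 1, ϖ^{−(a+c)}) =
latt diag(ϖ^a, 1, ϖ^{−a})` compares the valuations of the first entries). [cite: Serre1980Trees, I.6.4] -/
theorem eq_zero_of_mapGL_latt_apartment_selfDual_eq (t : GL (Fin 3) K) (ϖ : K) (hϖ : Valued.v ϖ = WithZero.exp (-1 : ℤ)) (c a : ℤ)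
    (ht : (t : Matrix (Fin 3) (Fin 3) K) = Matrix.diagonal ![ϖ ^ c, 1, ϖ ^ (-c)])
    (hfix : mapGL t (latt (Matrix.diagonal ![ϖ ^ a, 1, ϖ ^ (-a)])) = latt (Matrix.diagonal ![ϖ ^ a, 1, ϖ ^ (-a)])) : c = 0 := by
  have hϖ0 : ϖ ≠ 0 := fun h0 => by rw [h0, map_zero] at hϖ; exact WithZero.zero_ne_coe hϖ
  rw [mapGL_latt_apartment_selfDual_translate t ϖ hϖ0 c a ht] at hfix
  -- the vector `ϖ^(a+c) e₀` lies in the left lattice, hence in the right one: `|ϖ^(a+c)| ≤ |ϖ^a|`; symmetrically `|ϖ^a| ≤ |ϖ^(a+c)|`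
  have hd1 : ∀ i, (![ϖ ^ (a + c), (1 : K), ϖ ^ (-(a + c))]) i ≠ 0 := by
    intro i; fin_cases i
    · exact zpow_ne_zero _ hϖ0
    · exact one_ne_zero
    · exact zpow_ne_zero _ hϖ0
  have hd2 : ∀ i, (![ϖ ^ a, (1 : K), ϖ ^ (-a)]) i ≠ 0 := by
    intro i; fin_cases i
    · exact zpow_ne_zero _ hϖ0
    · exact one_ne_zero
    · exact zpow_ne_zero _ hϖ0
  have key : Valued.v (ϖ ^ (a + c)) = Valued.v (ϖ ^ a) := by
    apply le_antisymm
    · have hmem : (Pi.single 0 (ϖ ^ (a + c)) : Fin 3 → K) ∈ latt (Matrix.diagonal ![ϖ ^ a, 1, ϖ ^ (-a)]) := by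
        rw [← hfix, mem_latt_diagonal_iff hd1]
        intro i; fin_cases i <;> simp
      have := (mem_latt_diagonal_iff hd2 _).1 hmem 0
      simpa using this
    · have hmem : (Pi.single 0 (ϖ ^ a) : Fin 3 → K) ∈ latt (Matrix.diagonal ![ϖ ^ (a + c), 1, ϖ ^ (-(a + c))]) := by
        rw [hfix, mem_latt_diagonal_iff hd2]
        intro i; fin_cases i <;> simp
      have := (mem_latt_diagonal_iff hd1 _).1 hmem 0
      simpa using this
  rw [map_zpow₀, map_zpow₀, hϖ, ← WithZero.exp_zsmul, ← WithZero.exp_zsmul, smul_eq_mul, smul_eq_mul] at key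
  have := WithZero.exp_injective key
  omega

end Literature.NumberTheory.Automorphic.UnitaryLatticeTree

end
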